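import Mathlib
import Literature.MathematicalPhysics.QuantumFieldTheory.Balaban1983to89.B6Decomp247Lattice

/-!
# `Balaban1983to89.B6Decomp247LatticeTwoSided` — [Balaban1984PropagatorsII] Lemma 2.1: THE DECOMPOSITION DATA
# (2.47)/(2.48)/(2.57) OF `B6Lemma21Bridge` CONSTRUCTED UNDER PRINT'S LITERAL, TWO-SIDED READING OF (2.46) (*"a part of
# Γ contained in B^j(Λ_j) consists of bonds of the lattice Λ_j"*: a bond across an interface is a bond of the lattice of
# ONE of its end-points — the finer OR the coarser one), hence (2.61″) with the d-only constant c₁″ = 13c₀(½α)^{4d} and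
# `Lemma21TwoScale` for every contour system with a two-sided lattice drawing (GAPS G-B6-22 ≡ G-B6-p29-01, reading R0)

statement-level skeleton of published theorems with citation tags; proofs where landed; nothing here is a claim about the Yang–Mills mass gap

CITATION HEADER (lean-in-tree rule 2026-08-18).  Source: T. Bałaban, *Propagators and renormalization transformations for
lattice gauge theories. II*, Commun. Math. Phys. **96**, 223–250 (1984), doi:10.1007/bf01240221 [Balaban1984PropagatorsII]
(cell paper B6; PDF held: `paper:balaban1984-cmp96-propagators-rt-ii`, journal page = PDF page + 222; pp. 224, 231–234
[PDF 2, 9–12] re-read this generation from the text layer).  WHAT IS REPRODUCED: lit-balaban SKELETON rows **B6.Lem2.1**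
(Lemma 2.1 (2.60)–(2.63) p. 234), **B6.Eq2.56** ((2.57)–(2.58) p. 233), **B6.Eq2.47** ((2.47)–(2.48) pp. 231–232), and the
status annotation of **B6.Eq2.45** ((2.46) p. 231: the three typed readings R0/R1/R2 of the interface bonds, G-B6-22) —
cells only, no head change (the printed c₁(α) and the printed count (2.58) stay refuted as typed, G-A11-1 / G-B6-01a/b/c).
Unit `lit-balaban-p29` (Phase-2 proof seat p29, gen 12), HOME `run/shared/lean/pub/lit-balaban/`; B6 fold owner r03,
referee ref-4.  IMPORTS, NOT MODIFIED: `…B6Decomp247Lattice` (this seat, same generation: the one-sided structure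
`LatticeDrawing`, `spath`, the tower drawing; through it `…B6Lemma21Bridge` — `Step`/`pathC`/`pathF`/`pathV`, `Decomp247`,
`ineq261T_of_decomp`, `lemma21TwoScale_of_decomp` —, r03's `…B6Decomp247Surfaces`/`…B6Decomp247LevelGap` — the printed
decomposition (2.47) of every admissible contour, `aIdx`/`bIdx`/`eIdx`/`js`/`m`, `X_facts`, `S_zone`, `onSurf_aIdx`,
`js_step`, `js_one_bounds`, `js_m_bounds`, `length_ge_mul_episodes` — and `…B6TowerDecomp`'s step lemmas).  Nothing is
restated.

THE PRINTED TEXT (p. 231 [PDF 9]): *"Let us consider the sequence of domains B^j(Λ_j) ⊂ T^{(j)}, j = 1, 2, …, k. A boundary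
∂B^j(Λ_j) is a sum of (d−1)-dimensional cubes. Let us take the cubes which are not contained in the boundary ∂T^{(j)}. They
form a (d−1)-dimensional surface. We denote this surface by Σ_j … The surface Σ_j separates the sets B^j(Λ_j) and
B^{j−1}(Λ_{j−1}). For an arbitrary contour Γ on the lattice T_η we put |Γ| = nη, where n is a number of bonds the contour Γ
consists of. … a part of Γ contained in B^j(Λ_j) consists of bonds of the lattice Λ_j. Now we define d(y, y′) = inf …
(2.46)"*, with p. 224 [PDF 2] (2.1) *"Ω_j = B^j(Ω_j^{(j)})"* (the regions are unions of BLOCKS of their own lattice) and the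
decomposition (2.47), (2.48), (2.57), (2.58) quoted in the headers of `…B6Decomp247Surfaces` and `…B6Lemma21Bridge`.

THE POINT (GAPS G-B6-22).  Print fixes the lattice of a bond INSIDE a region B^j(Λ_j) and says nothing more about a bond
ACROSS an interface Σ_j; read literally with (2.1), a contour inside the coarse region B^j(Λ_j) moves by Λ_j-bonds up to
its boundary ∂B^j(Λ_j) ON BOTH KINDS OF FACES, so it LEAVES the region through a face of outward normal +e_ν by a bond of
the COARSER lattice Λ_j (landing on a Λ_j-point of the finer region) and through a face of outward normal −e_ν by a bond of
the FINER lattice (reading R0).  The dictionary's exact (len) rule `bscale (min zone)` — the one-sided `LatticeDrawing` of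
`…B6Decomp247Lattice` (reading R1) — allows only the finer bond across an interface; the two agree on the towers of
`B6LevelTower` (coarse regions on the +e₀ side only) and differ as soon as a coarse region has faces of both orientations
(every nested family of cubes).  THIS FILE carries the construction of `…B6Decomp247Lattice` over to R0.  Hypothesis
structure (§1) `TwoSidedDrawing G zone d A`: injective positions in an abelian group with a lattice frame ℤᵈ →+ A, every
admissible bond {u, v} an axis move of length `bscale q` for q THE ZONE OF ONE OF ITS END-POINTS (`bz`, the lattice of the
bond); every `LatticeDrawing` is one (`ofLatticeDrawing`).  The new phenomenon: a surface point y_l ∈ Σ_{j_l} of r03's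
decomposition may now be ENTERED from zone j_l − 1 by a Λ_{j_l}-bond (an ENTRY LETTER, `UpC`) and y′_l may be LEFT to zone
j_l − 1 by a Λ_{j_l}-bond (an EXIT LETTER, `DnC`) — bonds of the coarser lattice lying in print's crossing portions
Γ_{y′_{l−1},y_l}, Γ_{y′_l,y_{l+1}} ⊂ B^{j_l − 1}, whose other bonds are Λ_{j_l−1}-bonds.  §2 RE-SPLITS r03's index
intervals by these single letters: the surface code of episode l runs over [ε_l, β_l) with ε_l = e_l − [entry letter],
β_l = b_l + [exit letter] (`eps`, `bet`; `eps_le_bet`, `bet_le_eps_succ` — an exit letter goes down, an entry letter up,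
so they are never the same bond), and is read TWO-SCALE with the flag "Λ_{j_l−1}-bond" exactly as before; the first code
runs over [0, ε₁), the crossing codes over [β_l, ε_{l+1}).  The three lattice facts (D0) `bz_leg0` (first code: Λ_j-bonds
only, j = zone y), (D1) `bz_legS` (surface code: Λ_{j_l}- or Λ_{j_l−1}-bonds), (D2) `bz_legX` (crossing code:
Λ_{min{j_l,j_{l+1}}}-bonds only — a coarser first bond would be an exit letter, a coarser last bond an entry letter, and
after the last episode an entry letter is impossible by `js_m_bounds`) are proved from r03's zone facts (`zone_prefix`,
`zone_crossing`, `S_zone`) and the defining property of `bz`; with §1's displacement lemmas (`pos_sub_single`,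
`pos_sub_two`) they give `pos_sub_first`/`pos_sub_surf`/`pos_sub_cross` for the re-split portions and THE RECONSTRUCTION
`reconstruct` by the same induction as in the one-sided file, on the points v_{ε_l} and the indices j_l.  ONE STEP IS NEW:
j₁ is no longer the zone of the first coded point — `js_one_eq`: j₁ = zone(v_{ε₁}) + [entry letter] — and the entry bit is
not part of the data of `Decomp247`; it is DETERMINED by the point (`upS_one_ne`): were v_{ε₁} the first surface point
y₁ ∈ Σ_j of one contour and the foot of an entry letter into Σ_{j+1} of another, a two-bond chain would cross the level j,
against the walk form of (2.2) `LevelGap N` as soon as N ≥ 2 (print: N = RM ≫ 1).  Hence §3 `decomp247` — `Decomp247 g d y`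
for every base point of every realised, connected, separating, LevelGap-N (RM ≤ N, 2 ≤ N) contour system with a two-sided
lattice drawing and injective ι —, `ineq261T_of_twoSidedDrawing` ((2.61″) with c₁″), `sum_exp_le_of_twoSidedDrawing`,
`lemma21TwoScale_of_twoSidedDrawing`, `lemma21_full_of_twoSidedDrawing` ((2.60)–(2.63) with c₁″); §4 the towers once
more through `ofLatticeDrawing` (`towerDrawing₂`, `twGeo_ineq261T_of_twoSidedDrawing`, now with 1 ≤ a for N = a + 1 ≥ 2).

WHAT IS PROVED (kernel-checked; no `sorry`; axioms ⊆ {propext, Classical.choice, Quot.sound}; ONE new `structure`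
(`TwoSidedDrawing`, a hypothesis record with data), its conversion `ofLatticeDrawing`, the bookkeeping definitions
`dir`/`sgn`/`bz`/`toStep`/`bzAt`/`stepAt`/`steps`/`UpC`/`DnC`/`upS`/`dnS`/`eps`/`bet`/`leg0Of`/`legSOf`/`legXOf` with
bodies; 0 new `def … : Prop` facts).  Main declarations: `TwoSidedDrawing.reconstruct`, `TwoSidedDrawing.codes_length_eq_eps`,
`decomp247`, `ineq261T_of_twoSidedDrawing`, `lemma21TwoScale_of_twoSidedDrawing`, `lemma21_full_of_twoSidedDrawing`,
`towerDrawing₂`, `twGeo_ineq261T_of_twoSidedDrawing`.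

TYPING ∕ DIVERGENCE (honest).  (a) THE DICTIONARY as in `…B6Decomp247Lattice` TYPING (a), with the (len) rule RELAXED
to print's literal form: the lattice of an admissible bond is the zone of one of its end-points (which one is part of the
data `TwoSidedDrawing.step`, not prescribed: R0 proper — coarser bond through +e_ν faces, finer through −e_ν faces — , R1
(always the finer) and every intermediate assignment are instances; (2.46) is still the least NUMBER of bonds,
`B6Geometry.dist246`, so each admissible bond counts 1 whatever its lattice, as in print's *"|Γ| = nη … n is a number of
bonds"* read on the unit-scaled picture of (2.48)).  The touching reading R2 (`B6Geom246MultiLevelBox.bond`, `touchC`) is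
NOT a two-sided drawing either (a coarse block touches L^{d−1} fine blocks at distance 1; no L-free (2.61) constant).
(b) SURFACE POINTS are r03's walk-defined ones (`B6Decomp247Surfaces` TYPING (a): y_l = the first point of Γ on
Σ_{j_l} = a point of zone j_l with an admissible neighbour of zone j_l − 1), not print's geometric cubes of ∂B^j; the
re-split moves ONE bond at each end of a surface portion, so the portions of this file differ from print's Γ_{y_l,y′_l} by
at most the entry and exit letters, which print's text (bonds of Γ_{y′_l,y_{l+1}} ⊂ B^{j_{l,l+1}} are Λ_{j_{l,l+1}}-bonds)
tacitly places inside the surface portions as well.  (c) THE EXTRA HYPOTHESIS 2 ≤ N (beyond `…B6Decomp247Lattice`): used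
once, in `upS_one_ne`; print's N = RM is large in the paper's regime (M large, (2.59)), but `B6.Cond259` alone does not
force RM ≥ 2 (δ₀ is arbitrary), so it is displayed.  For N = 1 the configuration excluded by `upS_one_ne` (a point of Σ_j
joined upward by one admissible bond to a point of Σ_{j+1}) is consistent with `Separates` and `LevelGap 1`, so the
hypothesis is not removable by this argument.  (d) d-ONLY CONSTANT, PRINT'S TRADE, INDEXING, `[NeZero d]`: as in `…B6Decomp247Lattice`
TYPING (b), (c).  (e) INSTANCES IN THE TREE: the towers (§4, where R0 = R1).  A two-sided lattice drawing of a contour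
system on a GENERAL nested family of cube domains in reading R0 proper (the ℤᵈ carrier of `B15Ineq147LevelGap`, p21's box
`Domains`), together with the existence of admissible contours (connectedness) and the walk form of (2.2) for it, is NOT
constructed here (B6-CLOSURE §3.7(iv), second half; L–XL); for those carriers the tree's (2.61) remains the L-dependent
`K261` of the touching reading.  HONEST SCOPE: finite combinatorics (coding and decoding lattice walks) closing the
bookkeeping leaf H-B6.1 of a published proof, as repaired in the tree, under the literal reading of its distance; NOT the
printed constant, NOT a construction of print's domains, NOT anything analytic, NOT progress on any Clay problem.
-/

namespace Literature.MathematicalPhysics.QuantumFieldTheory.Balaban1983to89.B6Decomp247LatticeTwoSided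

open B6Geometry (Separates LevelGap ContourSystem Realizes dist246)
open B6Lemma21Bridge (Step pathC pathF pathV Decomp247)
open B6TowerDecomp (svec cvec_add_fvec cvec_of_fine_false fvec_of_fine_false cvec_of_fine_true fvec_of_fine_true
  pathV_cons pathC_cons pathF_cons pathC_nil pathF_nil pathV_nil)

/-! ## §1 Two-sided lattice drawings: every admissible bond is a bond of the lattice of ONE of its two end zones -/

section Drawing

variable {V : Type*} {G : SimpleGraph V} {zone : V → ℕ} {d : ℕ} {A : Type*} [AddCommGroup A]

/-- **A TWO-SIDED LATTICE DRAWING of a zoned graph of admissible bonds** (the hypothesis structure of this file; print's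
literal reading of (2.46), p. 231 *"a part of Γ contained in B^j(Λ_j) consists of bonds of the lattice Λ_j"*): every vertex
has a position in an abelian group `A` with a lattice frame `frame : ℤᵈ →+ A`, distinct vertices have distinct positions,
and every admissible bond `{u, v}` is an axis move of length `bscale q` in the frame for `q` THE ZONE OF ONE OF ITS TWO
END-POINTS (a Λ_q-bond of the territory B^q(Λ_q) it runs in: with Ω_j = B^j(Ω_j^{(j)}) (p. 224 (2.1)) a contour leaves a block
region through a face of outward normal −e_ν by a bond of the FINER lattice and through a face of outward normal +e_ν by a
bond of the COARSER lattice — both occur as soon as a coarse region has faces of both orientations; HOME/GAPS.md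
G-B6-22 ≡ G-B6-p29-01).  The one-sided structure `B6Decomp247Lattice.LatticeDrawing` (length = `bscale (min zone)`, the dictionary's
`B6LevelGapMetric.BondScale` in exact form) is the special case `q = min` (`ofLatticeDrawing` below); the towers of `B6LevelTower`
are of that kind. [cite: Balaban1984PropagatorsII, (2.46) p.231] -/
structure TwoSidedDrawing (G : SimpleGraph V) (zone : V → ℕ) (d : ℕ) (A : Type*) [AddCommGroup A] where
  /-- the position of a lattice point -/
  pos : V → A
  /-- the lattice frame: how a displacement of the unit lattice ℤᵈ acts on positions -/
  frame : (Fin d → ℤ) →+ A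
  /-- the length of a Λ_q-bond, in units of η (print: L^q) -/
  bscale : ℕ → ℤ
  /-- every admissible bond is an axis move of length `bscale q`, q the zone of one of its end-points -/
  step : ∀ ⦃u v : V⦄, G.Adj u v → ∃ μ : Fin d, ∃ s : ℤ, ∃ q : ℕ, (s = 1 ∨ s = -1) ∧ (q = zone u ∨ q = zone v) ∧
    pos v - pos u = frame (Pi.single μ (s * bscale q))
  /-- distinct lattice points have distinct positions -/
  inj : Function.Injective pos

namespace TwoSidedDrawing

/-- **Every one-sided lattice drawing is a two-sided one** (take q = min{zone u, zone v}, the zone of one of the two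
end-points): the coordinatised models of the tree (`B6Decomp247Lattice.LatticeDrawing.ofAxis`, the towers
`B6Decomp247Lattice.towerDrawing`) are two-sided lattice drawings. [cite: Balaban1984PropagatorsII, (2.46) p.231] -/
def ofLatticeDrawing (D₁ : B6Decomp247Lattice.LatticeDrawing G zone d A) : TwoSidedDrawing G zone d A where
  pos := D₁.pos
  frame := D₁.frame
  bscale := D₁.bscale
  step := by
    intro u v h
    obtain ⟨μ, s, hs, he⟩ := D₁.step h
    refine ⟨μ, s, min (zone u) (zone v), hs, ?_, he⟩
    rcases le_total (zone u) (zone v) with h | h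
    · exact Or.inl (min_eq_left h)
    · exact Or.inr (min_eq_right h)
  inj := D₁.inj

/-- The positions of the two-sided drawing of a one-sided one. [cite: Balaban1984PropagatorsII, (2.46) p.231] -/
@[simp] theorem ofLatticeDrawing_pos (D₁ : B6Decomp247Lattice.LatticeDrawing G zone d A) :
    (ofLatticeDrawing D₁).pos = D₁.pos := rfl

variable (D : TwoSidedDrawing G zone d A)

/-- The direction of an admissible bond. [cite: Balaban1984PropagatorsII, (2.46) p.231] -/
noncomputable def dir {u v : V} (h : G.Adj u v) : Fin d := (D.step h).choose

/-- The orientation (±1) of an admissible bond. [cite: Balaban1984PropagatorsII, (2.46) p.231] -/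
noncomputable def sgn {u v : V} (h : G.Adj u v) : ℤ := (D.step h).choose_spec.choose

/-- The LATTICE of an admissible bond: the zone `q ∈ {zone u, zone v}` whose Λ_q-bond it is.
[cite: Balaban1984PropagatorsII, (2.46) p.231] -/
noncomputable def bz {u v : V} (h : G.Adj u v) : ℕ := (D.step h).choose_spec.choose_spec.choose

/-- The defining property of direction, orientation and lattice of a bond. [cite: Balaban1984PropagatorsII, (2.46) p.231] -/
theorem bond_spec {u v : V} (h : G.Adj u v) :
    (D.sgn h = 1 ∨ D.sgn h = -1) ∧ (D.bz h = zone u ∨ D.bz h = zone v) ∧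
      D.pos v - D.pos u = D.frame (Pi.single (D.dir h) (D.sgn h * D.bscale (D.bz h))) :=
  (D.step h).choose_spec.choose_spec.choose_spec

/-- The STEP (direction, prescribed coarse/fine flag, orientation) read off an admissible bond u → v — one letter of
the leg codes of (2.58) (*"s(y) denotes a scaled image of y on unit lattice"*). [cite: Balaban1984PropagatorsII, (2.58) p.233] -/
noncomputable def toStep {u v : V} (h : G.Adj u v) (b : Bool) : Step d :=
  ⟨D.dir h, b, decide (D.sgn h = -1)⟩

/-- The flag of the step read off a bond is the prescribed one. [folklore] -/
private theorem toStep_fine {u v : V} (h : G.Adj u v) (b : Bool) : (D.toStep h b).fine = b := rfl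

/-- The unit vector of the step read off a bond is `sgn · e_dir` — one letter of the *"scaled image … on unit lattice"*
of (2.58) (same computation as `B6Decomp247Lattice.LatticeDrawing.svec_toStep`, for the two-sided structure). [folklore] -/
private theorem svec_toStep {u v : V} (h : G.Adj u v) (b : Bool) :
    svec (D.toStep h b) = Pi.single (D.dir h) (D.sgn h) := by
  have hs := (D.bond_spec h).1
  funext ν
  simp only [svec, toStep, Step.sign]
  by_cases hν : ν = D.dir h
  · rw [if_pos hν, hν, Pi.single_eq_same]
    rcases hs with h1 | h1 <;> simp [h1]
  · rw [if_neg hν, Pi.single_eq_of_ne hν]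

/-- **One admissible bond displaces the position by the frame image of `bscale (its lattice)` times the unit vector of
its step.** [cite: Balaban1984PropagatorsII, (2.46) p.231] -/
theorem pos_sub_eq_frame_svec {u v : V} (h : G.Adj u v) (b : Bool) :
    D.pos v - D.pos u = D.frame (D.bscale (D.bz h) • svec (D.toStep h b)) := by
  rw [(D.bond_spec h).2.2, svec_toStep]
  congr 1
  funext ν
  simp only [Pi.smul_apply, smul_eq_mul]
  by_cases hν : ν = D.dir h
  · rw [hν, Pi.single_eq_same, Pi.single_eq_same, mul_comm]
  · rw [Pi.single_eq_of_ne hν, Pi.single_eq_of_ne hν, mul_zero]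

/-- The lattice of the i-th bond of a contour (junk 0 past the end). [cite: Balaban1984PropagatorsII, (2.46) p.231] -/
noncomputable def bzAt {x x' : V} (p : G.Walk x x') (i : ℕ) : ℕ :=
  if h : i < p.length then D.bz (p.adj_getVert_succ h) else 0

/-- The lattice of a bond of a contour is the zone of one of its two end-points. [cite: Balaban1984PropagatorsII, (2.46) p.231] -/
theorem bzAt_mem {x x' : V} (p : G.Walk x x') {i : ℕ} (hi : i < p.length) :
    D.bzAt p i = zone (p.getVert i) ∨ D.bzAt p i = zone (p.getVert (i + 1)) := by
  simp only [bzAt, hi, dif_pos]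
  exact (D.bond_spec (p.adj_getVert_succ hi)).2.1

variable [NeZero d]

/-- The step of the i-th bond of a contour, with a prescribed flag (junk past the end of the contour). [cite: Balaban1984PropagatorsII, (2.58) p.233] -/
noncomputable def stepAt {x x' : V} (p : G.Walk x x') (flag : ℕ → Bool) (i : ℕ) : Step d :=
  if h : i < p.length then D.toStep (p.adj_getVert_succ h) (flag i) else ⟨0, false, false⟩

/-- The LEG CODE of the portion v_s … v_t of a contour: the list of the steps of its bonds.
[cite: Balaban1984PropagatorsII, (2.58) p.233] -/
noncomputable def steps {x x' : V} (p : G.Walk x x') (flag : ℕ → Bool) (s t : ℕ) : List (Step d) :=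
  (List.Ico s t).map (D.stepAt p flag)

/-- A leg code has one letter per bond (as `B6Decomp247Lattice.LatticeDrawing.steps_length`). [folklore] -/
private theorem steps_length {x x' : V} (p : G.Walk x x') (flag : ℕ → Bool) (s t : ℕ) :
    (D.steps p flag s t).length = t - s := by
  simp [steps]

/-- The empty portion codes the empty leg. [folklore] -/
private theorem steps_self {x x' : V} (p : G.Walk x x') (flag : ℕ → Bool) (s : ℕ) : D.steps p flag s s = [] := by
  simp [steps]

/-- Extending a portion by one bond appends its step. [folklore] -/
private theorem steps_succ {x x' : V} (p : G.Walk x x') (flag : ℕ → Bool) {s t : ℕ} (hst : s ≤ t) :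
    D.steps p flag s (t + 1) = D.steps p flag s t ++ [D.stepAt p flag t] := by
  simp [steps, List.Ico.succ_top hst]

end TwoSidedDrawing

/-- pathC of a concatenation of legs. [folklore] -/
private theorem pathC_append (l₁ l₂ : List (Step d)) : pathC (l₁ ++ l₂) = pathC l₁ + pathC l₂ := by
  induction l₁ with
  | nil => rw [List.nil_append, pathC_nil, zero_add]
  | cons s l ih => rw [List.cons_append, pathC_cons, pathC_cons, ih, add_assoc]

/-- pathF of a concatenation of legs. [folklore] -/
private theorem pathF_append (l₁ l₂ : List (Step d)) : pathF (l₁ ++ l₂) = pathF l₁ + pathF l₂ := by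
  induction l₁ with
  | nil => rw [List.nil_append, pathF_nil, zero_add]
  | cons s l ih => rw [List.cons_append, pathF_cons, pathF_cons, ih, add_assoc]

/-- pathV of a concatenation of legs. [folklore] -/
private theorem pathV_append (l₁ l₂ : List (Step d)) : pathV (l₁ ++ l₂) = pathV l₁ + pathV l₂ := by
  unfold pathV
  rw [pathC_append, pathF_append]
  abel

/-- pathV of a one-bond leg. [folklore] -/
private theorem pathV_singleton (s : Step d) : pathV [s] = svec s := by
  rw [pathV_cons, pathV_nil, add_zero]

/-- pathC of a one-bond leg. [folklore] -/
private theorem pathC_singleton (s : Step d) : pathC [s] = s.cvec := by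
  rw [pathC_cons, pathC_nil, add_zero]

/-- pathF of a one-bond leg. [folklore] -/
private theorem pathF_singleton (s : Step d) : pathF [s] = s.fvec := by
  rw [pathF_cons, pathF_nil, add_zero]

namespace TwoSidedDrawing

variable [NeZero d] (D : TwoSidedDrawing G zone d A)

/-- **Single-lattice portions: the code determines the displacement.** Along a portion v_s … v_t all of whose bonds are
Λ_q-bonds, `pos v_t − pos v_s = frame (bscale q · pathV (code))`. [cite: Balaban1984PropagatorsII, (2.47) p.231, (2.58) p.233] -/
theorem pos_sub_single {x x' : V} (p : G.Walk x x') (flag : ℕ → Bool) {s t : ℕ} (hst : s ≤ t)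
    (htn : t ≤ p.length) {q : ℕ} (hq : ∀ i, s ≤ i → i < t → D.bzAt p i = q) :
    D.pos (p.getVert t) - D.pos (p.getVert s) = D.frame (D.bscale q • pathV (D.steps p flag s t)) := by
  induction t, hst using Nat.le_induction with
  | base => rw [D.steps_self, pathV_nil, smul_zero, map_zero, sub_self]
  | succ t hst ih =>
    have ih' := ih (by omega) (fun i h1 h2 => hq i h1 (by omega))
    have hlt : t < p.length := by omega
    have hone := D.pos_sub_eq_frame_svec (p.adj_getVert_succ hlt) (flag t)
    have hbz : D.bz (p.adj_getVert_succ hlt) = q := by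
      have := hq t hst (Nat.lt_succ_self t)
      simp only [bzAt, hlt, dif_pos] at this
      exact this
    rw [hbz] at hone
    have hstep : D.stepAt p flag t = D.toStep (p.adj_getVert_succ hlt) (flag t) := by
      simp [stepAt, hlt]
    have htel : D.pos (p.getVert (t + 1)) - D.pos (p.getVert s) =
        (D.pos (p.getVert (t + 1)) - D.pos (p.getVert t)) + (D.pos (p.getVert t) - D.pos (p.getVert s)) := by abel
    rw [D.steps_succ p flag hst, pathV_append, pathV_singleton, smul_add, map_add, htel, ih', hstep, hone]
    abel

/-- **Two-lattice portions: the coarse and fine codes determine the displacement.** Along a portion v_s … v_t all of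
whose bonds are Λ_q- or Λ_{q−1}-bonds, flagging the Λ_{q−1}-bonds as fine,
`pos v_t − pos v_s = frame (bscale q · pathC (code) + bscale (q−1) · pathF (code))`.
[cite: Balaban1984PropagatorsII, (2.47) p.231, (2.58) p.233] -/
theorem pos_sub_two {x x' : V} (p : G.Walk x x') {s t : ℕ} (hst : s ≤ t) (htn : t ≤ p.length) {q : ℕ}
    (hq : ∀ i, s ≤ i → i < t → D.bzAt p i = q ∨ D.bzAt p i + 1 = q) :
    D.pos (p.getVert t) - D.pos (p.getVert s) =
      D.frame (D.bscale q • pathC (D.steps p (fun i => decide (D.bzAt p i < q)) s t)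
        + D.bscale (q - 1) • pathF (D.steps p (fun i => decide (D.bzAt p i < q)) s t)) := by
  set flag : ℕ → Bool := fun i => decide (D.bzAt p i < q) with hflag
  induction t, hst using Nat.le_induction with
  | base => rw [D.steps_self, pathC_nil, pathF_nil, smul_zero, smul_zero, add_zero, map_zero, sub_self]
  | succ t hst ih =>
    have ih' := ih (by omega) (fun i h1 h2 => hq i h1 (by omega))
    have hlt : t < p.length := by omega
    have hone := D.pos_sub_eq_frame_svec (p.adj_getVert_succ hlt) (flag t)
    have hbz : D.bzAt p t = D.bz (p.adj_getVert_succ hlt) := by simp only [bzAt, hlt, dif_pos]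
    have hstep : D.stepAt p flag t = D.toStep (p.adj_getVert_succ hlt) (flag t) := by
      simp [stepAt, hlt]
    have htel : D.pos (p.getVert (t + 1)) - D.pos (p.getVert s) =
        (D.pos (p.getVert (t + 1)) - D.pos (p.getVert t)) + (D.pos (p.getVert t) - D.pos (p.getVert s)) := by abel
    rw [D.steps_succ p flag hst, pathC_append, pathF_append, pathC_singleton, pathF_singleton, smul_add, smul_add,
      htel, ih', hstep]
    rcases hq t hst (Nat.lt_succ_self t) with h | h
    · -- a Λ_q-bond: coarse letter
      have hff : flag t = false := by simp only [hflag, h, lt_self_iff_false, decide_false]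
      have hf' : (D.toStep (p.adj_getVert_succ hlt) (flag t)).fine = false := by rw [toStep_fine, hff]
      rw [hbz] at h
      rw [cvec_of_fine_false _ hf', fvec_of_fine_false _ hf', smul_zero, hone, h, ← map_add]
      congr 1
      abel
    · -- a Λ_{q−1}-bond: fine letter
      have hft : flag t = true := by simp [hflag, ← h]
      have hf' : (D.toStep (p.adj_getVert_succ hlt) (flag t)).fine = true := by rw [toStep_fine, hft]
      have hq1 : q - 1 = D.bz (p.adj_getVert_succ hlt) := by rw [← hbz]; omega
      rw [cvec_of_fine_true _ hf', fvec_of_fine_true _ hf', smul_zero, hone, hq1, ← map_add]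
      congr 1
      abel

end TwoSidedDrawing

end Drawing

/-! ## §2 The portions of (2.47) re-split at the EXIT LETTERS, their codes, and the reconstruction -/

section Positions

open B6Decomp247Surfaces (OnSurf OnSomeSurf SurfAt aIdx eIdx bIdx js X_facts S_zone js_step js_one_bounds
  js_m_bounds js_zero js_m_succ eIdx_le_bIdx bIdx_le_eIdx_succ eIdx_m_succ eIdx_le_length bIdx_le_length
  zone_getVert_eIdx zone_getVert_bIdx eIdx_of_le bIdx_zero bIdx_lt_aIdx_succ aIdx_le_length onSurf_aIdx
  not_surfAt_of_lt_aIdx_one not_surfAt_X not_surfAt_tail zone_le_of_adj_of_not_onSomeSurf)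

variable {V : Type*} {G : SimpleGraph V} {zone : V → ℕ} {d : ℕ} {A : Type*} [AddCommGroup A]
variable (D : TwoSidedDrawing G zone d A) {x x' : V}

/-- `eIdx ≤ aIdx` (e_l = min{a_l, |Γ|}). [cite: Balaban1984PropagatorsII, (2.47) p.231] -/
theorem eIdx_le_aIdx (p : G.Walk x x') (l : ℕ) : eIdx zone p l ≤ aIdx zone p l := by
  unfold B6Decomp247Surfaces.eIdx
  exact min_le_left _ _

/-- **Zones along the first portion Γ_{y,y₁}**: every point before y₁ has zone j = zone y (surface-free start; zone rule
+ `X_facts`). [cite: Balaban1984PropagatorsII, (2.47) p.231] -/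
theorem zone_prefix (hsep : Separates G zone) (p : G.Walk x x') {i : ℕ} (hi : i < eIdx zone p 1) :
    zone (p.getVert i) = zone x := by
  rcases Nat.eq_zero_or_pos i with rfl | hpos
  · rw [p.getVert_zero]
  · have hX : ∀ k, bIdx zone p 0 ≤ k → k < eIdx zone p 1 →
        min (zone (p.getVert k)) (zone (p.getVert (k + 1))) = min (js zone p 0) (js zone p 1) :=
      (X_facts hsep p (l := 0) (Nat.zero_le _)).1
    rw [bIdx_zero, js_zero] at hX
    have h1 := (js_one_bounds hsep p).1
    have hmin := hX (i - 1) (Nat.zero_le _) (by omega)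
    rw [show i - 1 + 1 = i by omega, min_eq_left h1] at hmin
    have hfree : ¬ OnSomeSurf G zone (p.getVert i) :=
      not_surfAt_of_lt_aIdx_one p (lt_of_lt_of_le hi (eIdx_le_aIdx p 1))
    have hadj : G.Adj (p.getVert (i - 1)) (p.getVert i) := by
      have := p.adj_getVert_succ (i := i - 1) (by have := eIdx_le_length (zone := zone) p 1; omega)
      rwa [show i - 1 + 1 = i by omega] at this
    have hle := zone_le_of_adj_of_not_onSomeSurf hsep hadj hfree
    omega

/-- **Zones in the interior of a crossing portion Γ_{y′_l,y_{l+1}}**: every interior point has zone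
j_{l,l+1} = min{j_l, j_{l+1}} (surface-free stretch; zone rule + `X_facts`). [cite: Balaban1984PropagatorsII, (2.47) p.231] -/
theorem zone_crossing (hsep : Separates G zone) (p : G.Walk x x') {l i : ℕ} (hl : l ≤ B6Decomp247Surfaces.m zone p)
    (h1 : bIdx zone p l < i) (h2 : i < eIdx zone p (l + 1)) :
    zone (p.getVert i) = min (js zone p l) (js zone p (l + 1)) := by
  have hX := (X_facts hsep p hl).1
  have hlen := eIdx_le_length (zone := zone) p (l + 1)
  have hmin := hX (i - 1) (by omega) (by omega)
  rw [show i - 1 + 1 = i by omega] at hmin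
  have hfree : ¬ OnSomeSurf G zone (p.getVert i) :=
    not_surfAt_X p hl h1 (lt_of_lt_of_le h2 (eIdx_le_aIdx p (l + 1))) (by omega)
  have hadj : G.Adj (p.getVert (i - 1)) (p.getVert i) := by
    have := p.adj_getVert_succ (i := i - 1) (by omega)
    rwa [show i - 1 + 1 = i by omega] at this
  have hle := zone_le_of_adj_of_not_onSomeSurf hsep hadj hfree
  omega

namespace TwoSidedDrawing

/-- **THE ENTRY LETTER**: episode l is entered UPWARD by a bond of the COARSER lattice (the crossing portion
Γ_{y′_{l−1},y_l} ends with a Λ_{j_l}-bond from a point of zone j_l − 1 into y_l ∈ Σ_{j_l}: in print's geometry the entry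
into a block region through a face of outward normal +e_ν, GAPS G-B6-22). [cite: Balaban1984PropagatorsII, (2.46)–(2.47) p.231] -/
def UpC (p : G.Walk x x') (l : ℕ) : Prop :=
  1 ≤ eIdx zone p l ∧ zone (p.getVert (eIdx zone p l - 1)) + 1 = zone (p.getVert (eIdx zone p l)) ∧
    D.bzAt p (eIdx zone p l - 1) = zone (p.getVert (eIdx zone p l))

/-- **THE EXIT LETTER**: episode l is left DOWNWARD by a bond of the COARSER lattice (the crossing portion
Γ_{y′_l,y_{l+1}} starts with a Λ_{j_l}-bond from y′_l ∈ Σ_{j_l} to a point of zone j_l − 1: in print's geometry the exit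
from a block region through a face of outward normal +e_ν, GAPS G-B6-22). [cite: Balaban1984PropagatorsII, (2.46)–(2.47) p.231] -/
def DnC (p : G.Walk x x') (l : ℕ) : Prop :=
  bIdx zone p l < p.length ∧ zone (p.getVert (bIdx zone p l + 1)) + 1 = zone (p.getVert (bIdx zone p l)) ∧
    D.bzAt p (bIdx zone p l) = zone (p.getVert (bIdx zone p l))

open Classical in
/-- The shift of the start of the surface code of episode l: 1 if the episode (l ≤ m) is entered by an entry letter.
[cite: Balaban1984PropagatorsII, (2.47) p.231] -/
noncomputable def upS (p : G.Walk x x') (l : ℕ) : ℕ :=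
  if l ≤ B6Decomp247Surfaces.m zone p ∧ D.UpC p l then 1 else 0

open Classical in
/-- The shift of the end of the surface code of episode l: 1 if the episode is left by an exit letter.
[cite: Balaban1984PropagatorsII, (2.47) p.231] -/
noncomputable def dnS (p : G.Walk x x') (l : ℕ) : ℕ :=
  if D.DnC p l then 1 else 0

/-- The START INDEX of the (two-lattice) surface code of episode l: e_l, or e_l − 1 when entered by an entry letter;
for l = m + 1 it is |Γ|. [cite: Balaban1984PropagatorsII, (2.47) p.231] -/
noncomputable def eps (p : G.Walk x x') (l : ℕ) : ℕ := eIdx zone p l - D.upS p l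

/-- The END INDEX of the surface code of episode l: b_l, or b_l + 1 when left by an exit letter.
[cite: Balaban1984PropagatorsII, (2.47) p.231] -/
noncomputable def bet (p : G.Walk x x') (l : ℕ) : ℕ := bIdx zone p l + D.dnS p l

/-- `upS ≤ 1`. [folklore] -/
private theorem upS_le (p : G.Walk x x') (l : ℕ) : D.upS p l ≤ 1 := by
  unfold upS; split_ifs <;> omega

/-- `dnS ≤ 1`. [folklore] -/
private theorem dnS_le (p : G.Walk x x') (l : ℕ) : D.dnS p l ≤ 1 := by
  unfold dnS; split_ifs <;> omega

/-- `upS = 1 ↔ (l ≤ m ∧ UpC)`. [folklore] -/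
private theorem upS_eq_one_iff (p : G.Walk x x') (l : ℕ) :
    D.upS p l = 1 ↔ l ≤ B6Decomp247Surfaces.m zone p ∧ D.UpC p l := by
  unfold upS; split_ifs with h <;> simp [h]

/-- `dnS = 1 ↔ DnC`. [folklore] -/
private theorem dnS_eq_one_iff (p : G.Walk x x') (l : ℕ) : D.dnS p l = 1 ↔ D.DnC p l := by
  unfold dnS; split_ifs with h <;> simp [h]

/-- An entry letter needs e_l ≥ 1, so `upS ≤ e_l`. [folklore] -/
private theorem upS_le_eIdx (p : G.Walk x x') (l : ℕ) : D.upS p l ≤ eIdx zone p l := by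
  unfold upS
  split_ifs with h
  · exact h.2.1
  · exact Nat.zero_le _

/-- ε_{m+1} = |Γ| (no shift after the last episode). [cite: Balaban1984PropagatorsII, (2.47) p.231] -/
theorem eps_m_succ (p : G.Walk x x') : D.eps p (B6Decomp247Surfaces.m zone p + 1) = p.length := by
  unfold eps upS
  rw [if_neg (by omega), eIdx_m_succ, Nat.sub_zero]

/-- ε_l ≤ β_l (1 ≤ l ≤ m). [cite: Balaban1984PropagatorsII, (2.47) p.231] -/
theorem eps_le_bet (p : G.Walk x x') {l : ℕ} (hl1 : 1 ≤ l) (hl : l ≤ B6Decomp247Surfaces.m zone p) :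
    D.eps p l ≤ D.bet p l := by
  have h := eIdx_le_bIdx (zone := zone) p hl1 hl
  unfold eps bet
  omega

/-- β_l ≤ ε_{l+1} (1 ≤ l ≤ m): an exit letter and an entry letter are never the same bond (one goes down, the other up).
[cite: Balaban1984PropagatorsII, (2.47) p.231] -/
theorem bet_le_eps_succ (p : G.Walk x x') {l : ℕ} (hl1 : 1 ≤ l) (hl : l ≤ B6Decomp247Surfaces.m zone p) :
    D.bet p l ≤ D.eps p (l + 1) := by
  have hba := bIdx_lt_aIdx_succ (zone := zone) p hl1 hl
  have hbl := bIdx_le_length (zone := zone) p hl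
  have hu := D.upS_le p (l + 1)
  have hdn := D.dnS_le p l
  unfold eps bet
  rcases Nat.lt_or_ge (l + 1) (B6Decomp247Surfaces.m zone p + 1) with hlm | hlm
  · have he : eIdx zone p (l + 1) = aIdx zone p (l + 1) := eIdx_of_le p (by omega) (by omega)
    -- both shifts at once would make one bond go down and up
    by_contra hcon
    have h1 : D.dnS p l = 1 := by omega
    have h2 : D.upS p (l + 1) = 1 := by omega
    have hb : bIdx zone p l + 1 = eIdx zone p (l + 1) := by omega
    obtain ⟨-, hz1, -⟩ := (D.dnS_eq_one_iff p l).1 h1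
    obtain ⟨-, ⟨-, hz2, -⟩⟩ := (D.upS_eq_one_iff p (l + 1)).1 h2
    rw [← hb, Nat.add_sub_cancel] at hz2
    omega
  · have hlm' : l = B6Decomp247Surfaces.m zone p := by omega
    subst hlm'
    have h0 : D.upS p (B6Decomp247Surfaces.m zone p + 1) = 0 := by
      unfold upS; rw [if_neg (by omega)]
    rw [h0, eIdx_m_succ]
    rcases Nat.eq_zero_or_pos (D.dnS p (B6Decomp247Surfaces.m zone p)) with h | h
    · omega
    · have h1 : D.dnS p (B6Decomp247Surfaces.m zone p) = 1 := by omega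
      obtain ⟨hlt, -, -⟩ := (D.dnS_eq_one_iff p _).1 h1
      omega

/-- ε_{l+1} ≤ |Γ|. [folklore] -/
private theorem eps_le_length (p : G.Walk x x') (l : ℕ) : D.eps p l ≤ p.length := by
  have := eIdx_le_length (zone := zone) p l
  unfold eps; omega

variable [NeZero d]

/-- The code of the first portion (from y up to y₁, WITHOUT a final entry letter). [cite: Balaban1984PropagatorsII, (2.47) p.231, (2.58) p.233] -/
noncomputable def leg0Of (p : G.Walk x x') : List (Step d) :=
  D.steps p (fun _ => false) 0 (D.eps p 1)

/-- The two-lattice code of episode l+1 (print's l = ours + 1), INCLUDING its entry and exit letters, flag = Λ_{j−1}-bond.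
[cite: Balaban1984PropagatorsII, (2.47) p.231, (2.58) p.233] -/
noncomputable def legSOf (p : G.Walk x x') (l : ℕ) : List (Step d) :=
  D.steps p (fun i => decide (D.bzAt p i < js zone p (l + 1))) (D.eps p (l + 1)) (D.bet p (l + 1))

/-- The single-lattice code of the crossing portion after episode l+1, WITHOUT the exit/entry letters.
[cite: Balaban1984PropagatorsII, (2.47) p.231, (2.58) p.233] -/
noncomputable def legXOf (p : G.Walk x x') (l : ℕ) : List (Step d) :=
  D.steps p (fun _ => false) (D.bet p (l + 1)) (D.eps p (l + 2))

omit [NeZero d] in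
/-- **(D0) Every bond of the first code is a Λ_j-bond** (j = zone y): the only candidate of another lattice is an entry
letter into y₁, which the re-split removes (and which cannot exist if the contour meets no surface).
[cite: Balaban1984PropagatorsII, (2.46)–(2.47) p.231] -/
theorem bz_leg0 (hsep : Separates G zone) (p : G.Walk x x') {i : ℕ} (hi : i < D.eps p 1) : D.bzAt p i = zone x := by
  have hε : D.eps p 1 ≤ eIdx zone p 1 := Nat.sub_le _ _
  have he1 := eIdx_le_length (zone := zone) p 1
  have hie : i < eIdx zone p 1 := lt_of_lt_of_le hi hε
  have hil : i < p.length := by omega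
  have hzi : zone (p.getVert i) = zone x := zone_prefix hsep p hie
  rcases D.bzAt_mem p hil with h | h
  · rw [h, hzi]
  · rcases Nat.lt_or_ge (i + 1) (eIdx zone p 1) with hlt | hge
    · rw [h, zone_prefix hsep p hlt]
    · have heq : i + 1 = eIdx zone p 1 := by omega
      have hz1 : zone (p.getVert (i + 1)) = js zone p 1 := by rw [heq]; exact zone_getVert_eIdx p 1
      have hb := js_one_bounds hsep p
      rcases Nat.lt_or_ge (js zone p 1) (zone x + 1) with h1 | h1
      · rw [h, hz1]; omega
      · -- an entry letter into y₁: removed by the re-split, or impossible when no surface is met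
        exfalso
        have hup : D.UpC p 1 := by
          refine ⟨by omega, ?_, ?_⟩
          · rw [← heq, Nat.add_sub_cancel, hzi, hz1]; omega
          · rw [← heq, Nat.add_sub_cancel, h]
        rcases Nat.eq_zero_or_pos (B6Decomp247Surfaces.m zone p) with hm0 | hmpos
        · -- no surface met: but y₁ = y′ would be a surface point through v_i
          have hlen : eIdx zone p 1 = p.length := by rw [← eIdx_m_succ (zone := zone) p, hm0]
          have hsurf : OnSomeSurf G zone (p.getVert p.length) := by
            refine ⟨p.getVert i, ?_, ?_⟩
            · have := p.adj_getVert_succ hil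
              rwa [heq, hlen] at this
            · rw [hzi, ← hlen, ← heq, hz1]; omega
          have hnot := not_surfAt_tail (zone := zone) p (i := p.length) (by rw [hm0, bIdx_zero]; omega) le_rfl
          exact hnot hsurf
        · have hs : D.upS p 1 = 1 := (D.upS_eq_one_iff p 1).2 ⟨hmpos, hup⟩
          unfold eps at hi
          omega

omit [NeZero d] in
/-- **(D1) Every bond of the surface code of episode l is a Λ_{j_l}- or a Λ_{j_l−1}-bond** (the points of Γ_{y_l,y′_l}
have zones j_l, j_l − 1, `S_zone`; the entry and exit letters are Λ_{j_l}-bonds by definition).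
[cite: Balaban1984PropagatorsII, (2.46)–(2.47) p.231] -/
theorem bz_legS (hsep : Separates G zone) (p : G.Walk x x') {l : ℕ} (hl1 : 1 ≤ l)
    (hl : l ≤ B6Decomp247Surfaces.m zone p) {i : ℕ} (h1 : D.eps p l ≤ i) (h2 : i < D.bet p l) :
    D.bzAt p i = js zone p l ∨ D.bzAt p i + 1 = js zone p l := by
  have hS := S_zone hsep p hl1 hl
  have hea : eIdx zone p l = aIdx zone p l := eIdx_of_le p hl1 hl
  have hbl := bIdx_le_length (zone := zone) p hl
  have hu := D.upS_le p l
  have hdn := D.dnS_le p l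
  unfold eps at h1
  unfold bet at h2
  rcases Nat.lt_or_ge i (eIdx zone p l) with hlt | hge
  · -- the entry letter
    have hs : D.upS p l = 1 := by omega
    obtain ⟨-, ⟨-, -, hbz⟩⟩ := (D.upS_eq_one_iff p l).1 hs
    have hi : i = eIdx zone p l - 1 := by omega
    left
    rw [hi, hbz]
    exact zone_getVert_eIdx p l
  · rcases Nat.lt_or_ge i (bIdx zone p l) with hib | hib
    · -- inside Γ_{y_l,y′_l}
      have ha := hS i (by omega) hib.le
      have hb := hS (i + 1) (by omega) (by omega)
      rcases D.bzAt_mem p (i := i) (by omega) with h | h <;> omega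
    · -- the exit letter
      have hs : D.dnS p l = 1 := by omega
      obtain ⟨-, -, hbz⟩ := (D.dnS_eq_one_iff p l).1 hs
      have hi : i = bIdx zone p l := by omega
      left
      rw [hi, hbz, zone_getVert_bIdx p hl]

omit [NeZero d] in
/-- **(D2) Every bond of the crossing code after episode l is a Λ_{j_{l,l+1}}-bond** (interior points have zone
min{j_l, j_{l+1}}; a first bond of the coarser lattice would be an exit letter, a last one an entry letter — both
removed by the re-split; after the last episode an entry letter is impossible, `js_m_bounds`).
[cite: Balaban1984PropagatorsII, (2.46)–(2.47) p.231] -/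
theorem bz_legX (hsep : Separates G zone) (p : G.Walk x x') {l : ℕ}
    (hl : l ≤ B6Decomp247Surfaces.m zone p) {i : ℕ} (h1 : D.bet p l ≤ i) (h2 : i < D.eps p (l + 1)) :
    D.bzAt p i = min (js zone p l) (js zone p (l + 1)) := by
  obtain ⟨-, hX2, hX3⟩ := X_facts hsep p hl
  have hu := D.upS_le p (l + 1)
  have hdn := D.dnS_le p l
  have hel := eIdx_le_length (zone := zone) p (l + 1)
  unfold bet at h1
  unfold eps at h2
  have hbi : bIdx zone p l ≤ i := by omega
  have hie : i < eIdx zone p (l + 1) := by omega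
  have hil : i < p.length := by omega
  have hzb : zone (p.getVert (bIdx zone p l)) = js zone p l := zone_getVert_bIdx p hl
  have hze : zone (p.getVert (eIdx zone p (l + 1))) = js zone p (l + 1) := zone_getVert_eIdx p (l + 1)
  -- zones of the two end-points of the bond i
  have hzi : zone (p.getVert i) = js zone p l ∨ zone (p.getVert i) = min (js zone p l) (js zone p (l + 1)) := by
    rcases hbi.eq_or_lt with h | h
    · left; rw [← h, hzb]
    · right; exact zone_crossing hsep p hl h hie
  have hzi1 : zone (p.getVert (i + 1)) = js zone p (l + 1) ∨
      zone (p.getVert (i + 1)) = min (js zone p l) (js zone p (l + 1)) := by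
    rcases Nat.lt_or_ge (i + 1) (eIdx zone p (l + 1)) with h | h
    · right; exact zone_crossing hsep p hl (by omega) h
    · left; rw [show i + 1 = eIdx zone p (l + 1) by omega, hze]
  -- no exit letter at i = b_l unless shifted away
  have hnoDn : i = bIdx zone p l → ¬ D.DnC p l := by
    intro hib hdnc
    have : D.dnS p l = 1 := (D.dnS_eq_one_iff p l).2 hdnc
    omega
  -- no entry letter at i = e_{l+1} - 1 unless shifted away (and none after the last episode)
  have hnoUp : i + 1 = eIdx zone p (l + 1) → ¬ D.UpC p (l + 1) := by
    intro hie1 hupc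
    rcases Nat.lt_or_ge (l + 1) (B6Decomp247Surfaces.m zone p + 1) with hlm | hlm
    · have : D.upS p (l + 1) = 1 := (D.upS_eq_one_iff p (l + 1)).2 ⟨by omega, hupc⟩
      omega
    · -- l = m: the end-point y′ is never entered upward (zone y′ ≤ j_m, `js_m_bounds`)
      have hlm' : l = B6Decomp247Surfaces.m zone p := by omega
      obtain ⟨-, hz, -⟩ := hupc
      rw [← hie1, Nat.add_sub_cancel] at hz
      have hjs : js zone p (l + 1) = zone x' := by rw [hlm']; exact js_m_succ p
      have hjl : js zone p l = js zone p (B6Decomp247Surfaces.m zone p) := by rw [hlm']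
      have hb := (js_m_bounds hsep p).1
      have hz1 : zone (p.getVert (i + 1)) = js zone p (l + 1) := by rw [hie1]; exact hze
      rcases hzi with hz0 | hz0 <;> omega
  rcases D.bzAt_mem p hil with h | h
  · -- bz = zone v_i
    rcases hzi with hz | hz
    · -- v_i = y′_l (i = b_l) with bz = j_l: fine unless j_l > min, i.e. a downward exit letter
      rw [h, hz]
      by_contra hne
      have hib : i = bIdx zone p l := by
        by_contra hne'
        have := zone_crossing hsep p hl (i := i) (by omega) hie
        omega
      apply hnoDn hib
      refine ⟨by omega, ?_, ?_⟩
      · rw [← hib, hz]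
        rcases hzi1 with hz1 | hz1 <;> omega
      · rw [← hib, h]
    · rw [h, hz]
  · -- bz = zone v_{i+1}
    rcases hzi1 with hz1 | hz1
    · rw [h, hz1]
      by_contra hne
      have hie1 : i + 1 = eIdx zone p (l + 1) := by
        by_contra hne'
        have := zone_crossing hsep p hl (i := i + 1) (by omega) (by omega)
        omega
      apply hnoUp hie1
      refine ⟨by omega, ?_, ?_⟩
      · rw [← hie1, Nat.add_sub_cancel, hz1]
        rcases hzi with hz | hz <;> omega
      · rw [← hie1, Nat.add_sub_cancel, h]
    · rw [h, hz1]

omit [NeZero d] in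
/-- **j₁ read off the start of the first surface code**: j₁ = zone(v_{ε₁}) + [episode 1 is entered by an entry letter].
[cite: Balaban1984PropagatorsII, (2.47) p.231] -/
theorem js_one_eq (p : G.Walk x x') : js zone p 1 = zone (p.getVert (D.eps p 1)) + D.upS p 1 := by
  have hu := D.upS_le p 1
  rcases Nat.eq_zero_or_pos (D.upS p 1) with h0 | h1
  · unfold eps
    rw [h0, Nat.sub_zero, add_zero]
    exact (zone_getVert_eIdx p 1).symm
  · have h1' : D.upS p 1 = 1 := by omega
    obtain ⟨-, ⟨-, hz, -⟩⟩ := (D.upS_eq_one_iff p 1).1 h1'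
    unfold eps
    rw [h1', hz]
    exact (zone_getVert_eIdx p 1).symm

omit [NeZero d] in
/-- **The entry bit of the first episode is determined by the point v_{ε₁}** (used in the reconstruction): two
contours with equally many episodes reaching the same point at the start of their first surface codes either both
enter by an entry letter or both do not — otherwise that point lies on Σ_j (first surface point of one contour) and is
joined by ONE admissible bond to a point of zone j + 1 (entry letter of the other), a two-bond chain across the level j,
against the walk form of (2.2) (`LevelGap N`, N ≥ 2). [cite: Balaban1984PropagatorsII, (2.2) p.224, (2.47) p.231] -/
private theorem upS_one_ne (hsep : Separates G zone) {N : ℕ} (hgap : LevelGap G zone N) (hN : 2 ≤ N) {x₁ x₂ : V}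
    (p₁ : G.Walk x x₁) (p₂ : G.Walk x x₂)
    (hM : B6Decomp247Surfaces.m zone p₁ = B6Decomp247Surfaces.m zone p₂)
    (hv : p₁.getVert (D.eps p₁ 1) = p₂.getVert (D.eps p₂ 1)) (h₁ : D.upS p₁ 1 = 1) (h₂ : D.upS p₂ 1 = 0) :
    False := by
  obtain ⟨hm1, ⟨he1, hz, -⟩⟩ := (D.upS_eq_one_iff p₁ 1).1 h₁
  have hε₁ : D.eps p₁ 1 = eIdx zone p₁ 1 - 1 := by unfold eps; rw [h₁]
  have hε₂ : D.eps p₂ 1 = eIdx zone p₂ 1 := by unfold eps; rw [h₂, Nat.sub_zero]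
  have hel := eIdx_le_length (zone := zone) p₁ 1
  -- the entry letter P → Q of Γ₁
  have hPQ : G.Adj (p₁.getVert (eIdx zone p₁ 1 - 1)) (p₁.getVert (eIdx zone p₁ 1)) := by
    have := p₁.adj_getVert_succ (i := eIdx zone p₁ 1 - 1) (by omega)
    rwa [show eIdx zone p₁ 1 - 1 + 1 = eIdx zone p₁ 1 by omega] at this
  -- P is the first surface point y₁ of Γ₂: it lies on Σ_{zone P}
  have hm2 : 1 ≤ B6Decomp247Surfaces.m zone p₂ := hM ▸ hm1
  have hsurf := onSurf_aIdx p₂ (l := 1) le_rfl hm2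
  rw [← eIdx_of_le p₂ le_rfl hm2, ← hε₂, ← hv, hε₁] at hsurf
  obtain ⟨hzP, u, huP, hzu⟩ := hsurf
  -- the chain u → P → Q crosses the level zone P with two bonds
  have hzu' : zone u < zone (p₁.getVert (eIdx zone p₁ 1 - 1)) := by omega
  have hzQ : zone (p₁.getVert (eIdx zone p₁ 1 - 1)) < zone (p₁.getVert (eIdx zone p₁ 1)) := by omega
  have hlen := hgap hzu' hzQ (SimpleGraph.Walk.cons huP (SimpleGraph.Walk.cons hPQ SimpleGraph.Walk.nil))
  simp only [SimpleGraph.Walk.length_cons, SimpleGraph.Walk.length_nil] at hlen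
  have hsep' := hsep hPQ
  omega

/-- **v_{ε₁} is determined by the code of the first portion**: `pos v_{ε₁} − pos y = bscale j · pathV (leg0)` (D0).
[cite: Balaban1984PropagatorsII, (2.47)–(2.48) pp.231–232, (2.58) p.233] -/
theorem pos_sub_first (hsep : Separates G zone) (p : G.Walk x x') :
    D.pos (p.getVert (D.eps p 1)) - D.pos x = D.frame (D.bscale (zone x) • pathV (D.leg0Of p)) := by
  have hq : ∀ i, 0 ≤ i → i < D.eps p 1 → D.bzAt p i = zone x := fun i _ hi => D.bz_leg0 hsep p hi
  have h := D.pos_sub_single p (fun _ => false) (Nat.zero_le _) (D.eps_le_length p 1) hq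
  rwa [p.getVert_zero] at h

/-- **v_{β_l} is determined by v_{ε_l}, j_l and the two-lattice code of episode l** (D1):
`pos v_{β_l} − pos v_{ε_l} = bscale j_l · pathC + bscale (j_l − 1) · pathF`.
[cite: Balaban1984PropagatorsII, (2.47)–(2.48) pp.231–232, (2.58) p.233] -/
theorem pos_sub_surf (hsep : Separates G zone) (p : G.Walk x x') {l : ℕ} (hl1 : 1 ≤ l)
    (hl : l ≤ B6Decomp247Surfaces.m zone p) :
    D.pos (p.getVert (D.bet p l)) - D.pos (p.getVert (D.eps p l)) =
      D.frame (D.bscale (js zone p l) • pathC (D.legSOf p (l - 1))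
        + D.bscale (js zone p l - 1) • pathF (D.legSOf p (l - 1))) := by
  have hq : ∀ i, D.eps p l ≤ i → i < D.bet p l → D.bzAt p i = js zone p l ∨ D.bzAt p i + 1 = js zone p l :=
    fun i h1 h2 => D.bz_legS hsep p hl1 hl h1 h2
  have hbl : D.bet p l ≤ p.length := le_trans (D.bet_le_eps_succ p hl1 hl) (D.eps_le_length p (l + 1))
  have h := D.pos_sub_two p (D.eps_le_bet p hl1 hl) hbl hq
  have hl' : l - 1 + 1 = l := by omega
  simp only [legSOf, hl']
  exact h

/-- **v_{ε_{l+1}} is determined by v_{β_l}, j_l, j_{l+1} and the code of the crossing portion** (D2):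
`pos v_{ε_{l+1}} − pos v_{β_l} = bscale (min j_l j_{l+1}) · pathV`. [cite: Balaban1984PropagatorsII, (2.47)–(2.48) pp.231–232, (2.58) p.233] -/
theorem pos_sub_cross (hsep : Separates G zone) (p : G.Walk x x') {l : ℕ} (hl1 : 1 ≤ l)
    (hl : l ≤ B6Decomp247Surfaces.m zone p) :
    D.pos (p.getVert (D.eps p (l + 1))) - D.pos (p.getVert (D.bet p l)) =
      D.frame (D.bscale (min (js zone p l) (js zone p (l + 1))) • pathV (D.legXOf p (l - 1))) := by
  have hq : ∀ i, D.bet p l ≤ i → i < D.eps p (l + 1) → D.bzAt p i = min (js zone p l) (js zone p (l + 1)) :=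
    fun i h1 h2 => D.bz_legX hsep p hl h1 h2
  have h := D.pos_sub_single p (fun _ => false) (D.bet_le_eps_succ p hl1 hl) (D.eps_le_length p (l + 1)) hq
  have e1 : l - 1 + 1 = l := by omega
  have e2 : l - 1 + 2 = l + 1 := by omega
  simp only [legXOf, e1, e2]
  exact h

/-- **THE RECONSTRUCTION BEHIND THE COUNT (2.58) for the two-sided reading**: two admissible contours from y whose
end-points have the same zone, with the same number of episodes, the same leg codes and the same branch signs END AT
THE SAME POINT — induction along the episodes on the points v_{ε_l} and the indices j_l: v_{ε₁} from the first code
(`pos_sub_first`, injectivity), j₁ from v_{ε₁} and the entry bit, itself determined (`upS_one_ne`, the one place where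
`LevelGap N`, N ≥ 2 enters); then v_{β_l} (`pos_sub_surf`), j_{l+1} = j_l ± 1 from the sign, v_{ε_{l+1}} (`pos_sub_cross`).
[cite: Balaban1984PropagatorsII, (2.47) p.231, (2.58) p.233] -/
theorem reconstruct (hsep : Separates G zone) {N : ℕ} (hgap : LevelGap G zone N) (hN : 2 ≤ N) {x₁ x₂ : V}
    (p₁ : G.Walk x x₁) (p₂ : G.Walk x x₂)
    (hz : zone x₁ = zone x₂) (hM : B6Decomp247Surfaces.m zone p₁ = B6Decomp247Surfaces.m zone p₂)
    (h0 : pathV (D.leg0Of p₁) = pathV (D.leg0Of p₂))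
    (hC : ∀ l, l < B6Decomp247Surfaces.m zone p₁ → pathC (D.legSOf p₁ l) = pathC (D.legSOf p₂ l))
    (hF : ∀ l, l < B6Decomp247Surfaces.m zone p₁ → pathF (D.legSOf p₁ l) = pathF (D.legSOf p₂ l))
    (hXc : ∀ l, l < B6Decomp247Surfaces.m zone p₁ → pathV (D.legXOf p₁ l) = pathV (D.legXOf p₂ l))
    (hb : ∀ l, l + 1 < B6Decomp247Surfaces.m zone p₁ →
      ((js zone p₁ (l + 2) : ℤ) - js zone p₁ (l + 1) ≤ 0 ↔ (js zone p₂ (l + 2) : ℤ) - js zone p₂ (l + 1) ≤ 0)) :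
    x₁ = x₂ := by
  have key : ∀ l, 1 ≤ l → l ≤ B6Decomp247Surfaces.m zone p₁ + 1 →
      D.pos (p₁.getVert (D.eps p₁ l)) = D.pos (p₂.getVert (D.eps p₂ l)) ∧ js zone p₁ l = js zone p₂ l := by
    intro l hl1 hlM
    induction l, hl1 using Nat.le_induction with
    | base =>
      have e₁ := D.pos_sub_first hsep p₁
      have e₂ := D.pos_sub_first hsep p₂
      rw [h0] at e₁
      have hpos : D.pos (p₁.getVert (D.eps p₁ 1)) = D.pos (p₂.getVert (D.eps p₂ 1)) :=
        sub_left_inj.mp (e₁.trans e₂.symm)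
      refine ⟨hpos, ?_⟩
      have hv := D.inj hpos
      have hu : D.upS p₁ 1 = D.upS p₂ 1 := by
        have hu₁ := D.upS_le p₁ 1
        have hu₂ := D.upS_le p₂ 1
        rcases Nat.eq_zero_or_pos (D.upS p₁ 1) with ha | ha <;>
          rcases Nat.eq_zero_or_pos (D.upS p₂ 1) with ha' | ha'
        · omega
        · exact (D.upS_one_ne hsep hgap hN p₂ p₁ hM.symm hv.symm (by omega) ha).elim
        · exact (D.upS_one_ne hsep hgap hN p₁ p₂ hM hv (by omega) ha').elim
        · omega
      rw [D.js_one_eq p₁, D.js_one_eq p₂, hv, hu]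
    | succ l hl1 ih =>
      obtain ⟨ihpos, ihj⟩ := ih (by omega)
      have hlM₁ : l ≤ B6Decomp247Surfaces.m zone p₁ := by omega
      have hlM₂ : l ≤ B6Decomp247Surfaces.m zone p₂ := by omega
      -- the surface code of episode l (with its entry/exit letters)
      have s₁ := D.pos_sub_surf hsep p₁ hl1 hlM₁
      have s₂ := D.pos_sub_surf hsep p₂ hl1 hlM₂
      rw [hC (l - 1) (by omega), hF (l - 1) (by omega), ihj] at s₁
      have hposb : D.pos (p₁.getVert (D.bet p₁ l)) = D.pos (p₂.getVert (D.bet p₂ l)) := by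
        have h := s₁.trans s₂.symm
        rw [ihpos] at h
        exact sub_left_inj.mp h
      -- the index of the next surface
      have hj : js zone p₁ (l + 1) = js zone p₂ (l + 1) := by
        rcases Nat.lt_or_ge l (B6Decomp247Surfaces.m zone p₁) with hlt | hge
        · have st₁ := js_step hsep p₁ hl1 (show l + 1 ≤ B6Decomp247Surfaces.m zone p₁ by omega)
          have st₂ := js_step hsep p₂ hl1 (show l + 1 ≤ B6Decomp247Surfaces.m zone p₂ by omega)
          have hbit := hb (l - 1) (by omega)
          rw [show l - 1 + 2 = l + 1 by omega, show l - 1 + 1 = l by omega] at hbit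
          rw [ihj] at st₁
          by_cases hc : (js zone p₁ (l + 1) : ℤ) - js zone p₁ l ≤ 0
          · have hc₂ := hbit.mp hc
            omega
          · have hc₂ : ¬ ((js zone p₂ (l + 1) : ℤ) - js zone p₂ l ≤ 0) := fun h => hc (hbit.mpr h)
            omega
        · have e₁ : js zone p₁ (l + 1) = zone x₁ := by
            rw [show l = B6Decomp247Surfaces.m zone p₁ by omega]; exact js_m_succ p₁
          have e₂ : js zone p₂ (l + 1) = zone x₂ := by
            rw [show l = B6Decomp247Surfaces.m zone p₂ by omega]; exact js_m_succ p₂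
          rw [e₁, e₂, hz]
      -- the crossing code after episode l
      have c₁ := D.pos_sub_cross hsep p₁ hl1 hlM₁
      have c₂ := D.pos_sub_cross hsep p₂ hl1 hlM₂
      rw [hXc (l - 1) (by omega), ihj, hj] at c₁
      have hpose : D.pos (p₁.getVert (D.eps p₁ (l + 1))) = D.pos (p₂.getVert (D.eps p₂ (l + 1))) := by
        have h := c₁.trans c₂.symm
        rw [hposb] at h
        exact sub_left_inj.mp h
      exact ⟨hpose, hj⟩
  obtain ⟨hfin, -⟩ := key (B6Decomp247Surfaces.m zone p₁ + 1) (by omega) le_rfl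
  have h₁ : p₁.getVert (D.eps p₁ (B6Decomp247Surfaces.m zone p₁ + 1)) = x₁ := by
    rw [D.eps_m_succ p₁, p₁.getVert_length]
  have h₂ : p₂.getVert (D.eps p₂ (B6Decomp247Surfaces.m zone p₁ + 1)) = x₂ := by
    rw [hM, D.eps_m_succ p₂, p₂.getVert_length]
  rw [h₁, h₂] at hfin
  exact D.inj hfin

/-- **THE RE-SPLIT PORTIONS TILE THE CONTOUR**: the first code and the surface and crossing codes of the first n
episodes have together ε_{n+1} letters ([0, ε₁), [ε_l, β_l), [β_l, ε_{l+1}) are consecutive: every bond is coded exactly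
once, the exit/entry letters inside the surface codes). [cite: Balaban1984PropagatorsII, (2.47)–(2.48) pp.231–232] -/
theorem codes_length_eq_eps (p : G.Walk x x') {n : ℕ} (hn : n ≤ B6Decomp247Surfaces.m zone p) :
    (D.leg0Of p).length + ∑ l ∈ Finset.range n, (D.legSOf p l).length
      + ∑ l ∈ Finset.range n, (D.legXOf p l).length = D.eps p (n + 1) := by
  induction n with
  | zero => simp [leg0Of, steps_length]
  | succ n ih =>
    have ih' := ih (by omega)
    have h1 := D.eps_le_bet p (l := n + 1) (by omega) (by omega)
    have h2 := D.bet_le_eps_succ p (l := n + 1) (by omega) (by omega)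
    have hS : (D.legSOf p n).length = D.bet p (n + 1) - D.eps p (n + 1) := D.steps_length p _ _ _
    have hX : (D.legXOf p n).length = D.eps p (n + 1 + 1) - D.bet p (n + 1) := D.steps_length p _ _ _
    have h2' : D.bet p (n + 1) ≤ D.eps p (n + 1 + 1) := h2
    rw [Finset.sum_range_succ, Finset.sum_range_succ, hS, hX]
    omega

/-- **THE TOTAL CODE LENGTH IS THE NUMBER OF BONDS** ((2.48) first line; `codes_length_eq_eps` at n = m and
ε_{m+1} = |Γ|; same display as `B6Decomp247Lattice.LatticeDrawing.codes_length` for the re-split codes). [folklore] -/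
private theorem codes_length (p : G.Walk x x') :
    (D.leg0Of p).length + ∑ l ∈ Finset.range (B6Decomp247Surfaces.m zone p), (D.legSOf p l).length
      + ∑ l ∈ Finset.range (B6Decomp247Surfaces.m zone p), (D.legXOf p l).length = p.length := by
  rw [D.codes_length_eq_eps p le_rfl, D.eps_m_succ]

end TwoSidedDrawing

end Positions

/-! ## §3 `Decomp247` CONSTRUCTED for every two-sided lattice drawing; (2.61″) and Lemma 2.1 with the d-only constant -/

section Assembly

open B6Decomp247Surfaces (js js_step js_one_bounds js_m_bounds js_zero js_m_succ X_facts)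
open B6Decomp247LevelGap (length_ge_mul_episodes)
open B6Decomp247Lattice (spath spath_length dist_eq_spath_length)

variable {g : B6.Geometry} {C : ContourSystem g} {d : ℕ} [NeZero d] {A : Type*} [AddCommGroup A]

/-- **THE DECOMPOSITION DATA (2.47)/(2.48)/(2.57) OF `B6Lemma21Bridge` — CONSTRUCTED, for every base point, on every
contour system carrying a TWO-SIDED LATTICE DRAWING** (print's literal reading R0 of (2.46); realising the geometry,
connected, surfaces separating, walk form `LevelGap N` of (2.2) with `RM ≤ N` AND `2 ≤ N`): per end-point y′ the printed
decomposition of a SHORTEST admissible contour (`B6Decomp247Surfaces`: m, j_l, y_l, y′_l), its portions RE-SPLIT at the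
exit/entry letters of the coarser lattice (`eps`, `bet`) and coded by their signed axis steps — `hstep` (`js_step`),
`hfirst` (`js_one_bounds`), `hlast` (`js_m_bounds`), `hzero` (`X_facts`), `hsep` = RM(m − 1) ≤ d(y, y′) ((2.57),
`length_ge_mul_episodes`), `hwt` ((2.48), `codes_length_eq_eps`), `hinj` = THE RECONSTRUCTION (`reconstruct`, N ≥ 2).
[cite: Balaban1984PropagatorsII, (2.47)–(2.48) pp.231–232, (2.57)–(2.58) p.233] -/
noncomputable def decomp247 (D : TwoSidedDrawing C.bond C.zone d A) (hreal : Realizes g C) (hconn : C.bond.Connected)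
    (hsep : Separates C.bond C.zone) {N : ℕ} (hgap : LevelGap C.bond C.zone N) (hRM : g.R * g.M ≤ N) (hN : 2 ≤ N)
    (hι : Function.Injective C.ι) (y : g.Site) : Decomp247 g d y where
  m y' := B6Decomp247Surfaces.m C.zone (spath hconn y y')
  js y' l := (js C.zone (spath hconn y y') (l + 1) : ℤ)
  leg0 y' := D.leg0Of (spath hconn y y')
  legS y' l := D.legSOf (spath hconn y y') l
  legX y' l := D.legXOf (spath hconn y y') l
  hstep y' l hl := by
    have h := js_step hsep (spath hconn y y') (l := l + 1) (by omega) (by omega)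
    rw [abs_le]
    constructor <;> omega
  hfirst y' hm := by
    have h := js_one_bounds hsep (spath hconn y y')
    rw [C.zone_ι] at h
    change |((js C.zone (spath hconn y y') 1 : ℕ) : ℤ) - (g.scale y : ℤ)| ≤ 1
    rw [abs_le]
    constructor <;> omega
  hlast y' hm := by
    have h := js_m_bounds hsep (spath hconn y y')
    rw [C.zone_ι] at h
    have e : B6Decomp247Surfaces.m C.zone (spath hconn y y') - 1 + 1 = B6Decomp247Surfaces.m C.zone (spath hconn y y') := by omega
    rw [e, abs_le]
    constructor <;> omega
  hzero y' hm := by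
    have hX := (X_facts hsep (spath hconn y y') (l := 0) (Nat.zero_le _)).2
    have e : js C.zone (spath hconn y y') 1 = g.scale y' := by
      rw [← C.zone_ι y', ← js_m_succ (zone := C.zone) (spath hconn y y'), hm]
    rw [js_zero, C.zone_ι, e] at hX
    rw [abs_le]
    constructor <;> omega
  hsep y' := by
    have h := length_ge_mul_episodes hsep hgap (spath hconn y y')
    rw [dist_eq_spath_length hreal hconn]
    calc g.R * g.M * ((B6Decomp247Surfaces.m C.zone (spath hconn y y') - 1 : ℕ) : ℝ)
        ≤ (N : ℝ) * ((B6Decomp247Surfaces.m C.zone (spath hconn y y') - 1 : ℕ) : ℝ) :=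
          mul_le_mul_of_nonneg_right hRM (Nat.cast_nonneg _)
      _ = ((N * (B6Decomp247Surfaces.m C.zone (spath hconn y y') - 1) : ℕ) : ℝ) := by push_cast; ring
      _ ≤ ((spath hconn y y').length : ℝ) := by exact_mod_cast h
  hwt y' := by
    rw [dist_eq_spath_length hreal hconn, D.codes_length]
  hinj y₁ y₂ hsc hm h0 hC hF hX hb := by
    apply hι
    exact D.reconstruct hsep hgap hN (spath hconn y y₁) (spath hconn y y₂) (by rw [C.zone_ι, C.zone_ι, hsc])
      hm h0 hC hF hX hb

/-- **(2.61″) WITH THE d-ONLY CONSTANT c₁″ = 13c₀(½α)^{4d} FOR EVERY CONTOUR SYSTEM WITH A TWO-SIDED LATTICE DRAWING**: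
`sup_y Σ_{y′} e^{−αδ₀d(y,y′)} ≤ c₁″` under (2.59) — `B6Lemma21Bridge.ineq261T_of_decomp` fed with the constructed data.
The constant depends on d, δ₀, α only. The printed c₁(α) = 12c₀(½α)^d stays refuted as typed (`B6Lemma21Counterexample`).
[cite: Balaban1984PropagatorsII, Lemma 2.1 (2.61) p.234, (2.54)–(2.59) p.233; corrected] -/
theorem ineq261T_of_twoSidedDrawing (D : TwoSidedDrawing C.bond C.zone d A) (hreal : Realizes g C)
    (hconn : C.bond.Connected) (hsep : Separates C.bond C.zone) {N : ℕ} (hgap : LevelGap C.bond C.zone N)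
    (hRM : g.R * g.M ≤ N) (hN : 2 ≤ N) (hι : Function.Injective C.ι) {δ₀ α : ℝ} (hα : 0 < α) (hδ : 0 < δ₀)
    (h259 : B6.Cond259 d δ₀ α g.R g.M) :
    B6Lemma21Repaired.Ineq261With (B6Lemma21TwoScale.c1TwoScale d δ₀ α) g δ₀ α :=
  B6Lemma21Bridge.ineq261T_of_decomp hα hδ h259 (decomp247 D hreal hconn hsep hgap hRM hN hι)

/-- **THE ROW SUM AS A NUMBER**: `Σ_{y′∈𝔅} e^{−αδ₀d(y,y′)} ≤ 13c₀(½α)^{4d}` for every base point.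
[cite: Balaban1984PropagatorsII, (2.61) p.234; corrected] -/
theorem sum_exp_le_of_twoSidedDrawing (D : TwoSidedDrawing C.bond C.zone d A) (hreal : Realizes g C)
    (hconn : C.bond.Connected) (hsep : Separates C.bond C.zone) {N : ℕ} (hgap : LevelGap C.bond C.zone N)
    (hRM : g.R * g.M ≤ N) (hN : 2 ≤ N) (hι : Function.Injective C.ι) {δ₀ α : ℝ} (hα : 0 < α) (hδ : 0 < δ₀)
    (h259 : B6.Cond259 d δ₀ α g.R g.M) (y : g.Site) :
    ∑ y' : g.Site, Real.exp (-(α * δ₀ * g.dist y y')) ≤ 13 * B6.c0 δ₀ (α / 2) ^ (4 * d) :=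
  ineq261T_of_twoSidedDrawing D hreal hconn hsep hgap hRM hN hι hα hδ h259 y

variable {I : Type}

/-- **LEMMA 2.1 WITH THE d-ONLY TWO-SCALE CONSTANT FOR EVERY FAMILY OF GEOMETRIES WITH TWO-SIDED LATTICE DRAWINGS**:
`B6Lemma21TwoScale.Lemma21TwoScale d δ₀ geo` — (2.60) ∧ (2.61″) under 0 < α < 1 and (2.59) — with no decomposition
hypothesis left. [cite: Balaban1984PropagatorsII, Lemma 2.1 (2.60)–(2.61) p.234; corrected] -/
theorem lemma21TwoScale_of_twoSidedDrawing (d : ℕ) [NeZero d] (δ₀ : ℝ) (hδ : 0 < δ₀) (geo : I → B6.Geometry)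
    (C : ∀ i, ContourSystem (geo i)) (N : I → ℕ) (A : I → Type*) [∀ i, AddCommGroup (A i)]
    (D : ∀ i, TwoSidedDrawing (C i).bond (C i).zone d (A i))
    (hreal : ∀ i, Realizes (geo i) (C i)) (hconn : ∀ i, (C i).bond.Connected)
    (hsep : ∀ i, Separates (C i).bond (C i).zone) (hgap : ∀ i, LevelGap (C i).bond (C i).zone (N i))
    (hRM : ∀ i, (geo i).R * (geo i).M ≤ N i) (hN : ∀ i, 2 ≤ N i) (hι : ∀ i, Function.Injective (C i).ι) :
    B6Lemma21TwoScale.Lemma21TwoScale d δ₀ geo :=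
  B6Lemma21Bridge.lemma21TwoScale_of_decomp d δ₀ hδ geo C N hreal hconn hgap hRM
    (fun i _ y => decomp247 (D i) (hreal i) (hconn i) (hsep i) (hgap i) (hRM i) (hN i) (hι i) y)

/-- **ALL FOUR DISPLAYS (2.60)–(2.63) OF LEMMA 2.1 WITH c₁″** for every family of geometries with two-sided lattice
drawings, under 0 < α < 1 and (2.59). [cite: Balaban1984PropagatorsII, Lemma 2.1 (2.60)–(2.63) p.234; corrected] -/
theorem lemma21_full_of_twoSidedDrawing (d : ℕ) [NeZero d] (δ₀ : ℝ) (hδ : 0 < δ₀) (geo : I → B6.Geometry)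
    (C : ∀ i, ContourSystem (geo i)) (N : I → ℕ) (A : I → Type*) [∀ i, AddCommGroup (A i)]
    (D : ∀ i, TwoSidedDrawing (C i).bond (C i).zone d (A i))
    (hreal : ∀ i, Realizes (geo i) (C i)) (hconn : ∀ i, (C i).bond.Connected)
    (hsep : ∀ i, Separates (C i).bond (C i).zone) (hgap : ∀ i, LevelGap (C i).bond (C i).zone (N i))
    (hRM : ∀ i, (geo i).R * (geo i).M ≤ N i) (hN : ∀ i, 2 ≤ N i) (hι : ∀ i, Function.Injective (C i).ι) :
    ∀ i : I, (geo i).Hyp21_22 → ∀ α : ℝ, 0 < α → α < 1 → B6.Cond259 d δ₀ α (geo i).R (geo i).M →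
      B6RandomWalk.Ineq260 (geo i) δ₀ α ∧
        B6Lemma21Repaired.Ineq261With (B6Lemma21TwoScale.c1TwoScale d δ₀ α) (geo i) δ₀ α ∧
        B6Lemma21Repaired.Ineq262With (B6Lemma21TwoScale.c1TwoScale d δ₀ α) (geo i) δ₀ α ∧
        B6Lemma21Repaired.Ineq263With (B6Lemma21TwoScale.c1TwoScale d δ₀ α) (geo i) δ₀ α :=
  B6Lemma21TwoScale.lemma21TwoScale_full d δ₀ hδ.le geo
    (fun i => B6Geometry.triangle254_of_realizes (hreal i) (hconn i))
    (lemma21TwoScale_of_twoSidedDrawing d δ₀ hδ geo C N A D hreal hconn hsep hgap hRM hN hι)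

end Assembly

/-! ## §4 Cross-check: the towers through the two-sided route -/

section Tower

open B6LevelTower

variable (d : ℕ) [NeZero d] (k a mm L : ℕ) (η R : ℝ)

/-- **THE TOWER AS A TWO-SIDED LATTICE DRAWING** (via its one-sided drawing `B6Decomp247Lattice.towerDrawing`: on a
tower every interface bond is a bond of the finer lattice, readings R0 = R1). [cite: Balaban1984PropagatorsII, (2.46) p.231] -/
noncomputable def towerDrawing₂ (hL : 1 ≤ L) :
    TwoSidedDrawing (twCS d k a mm L η R).bond (twCS d k a mm L η R).zone d (Fin d → ℤ) :=
  TwoSidedDrawing.ofLatticeDrawing (B6Decomp247Lattice.towerDrawing d k a mm L η R hL)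

/-- **(2.61″) ON EVERY TOWER BY THE TWO-SIDED ROUTE** (L ≥ 1, a ≥ 1 so that N = a + 1 ≥ 2, RM ≤ a + 1, (2.59)):
the conclusion of `B6TowerDecomp.twGeo_ineq261T` / `B6Decomp247Lattice.twGeo_ineq261T_of_latticeDrawing` once more.
[cite: Balaban1984PropagatorsII, Lemma 2.1 (2.61) p.234; corrected] -/
theorem twGeo_ineq261T_of_twoSidedDrawing {L : ℕ} (hL : 1 ≤ L) (ha : 1 ≤ a) (hRM : R * (mm : ℝ) ≤ (a : ℝ) + 1)
    {δ₀ α : ℝ} (hα : 0 < α) (hδ : 0 < δ₀) (h259 : B6.Cond259 d δ₀ α R mm) :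
    B6Lemma21Repaired.Ineq261With (B6Lemma21TwoScale.c1TwoScale d δ₀ α) (twGeo d k a mm L η R) δ₀ α :=
  ineq261T_of_twoSidedDrawing (towerDrawing₂ d k a mm L η R hL) (twGeo_realizes d k a mm L η R)
    (twCS_connected d k a mm L η R) (twCS_separates d k a mm L η R) (twCS_levelGap d k a mm L η R hL)
    (by push_cast; exact hRM) (by omega) (fun _ _ h => h) hα hδ h259

end Tower

end Literature.MathematicalPhysics.QuantumFieldTheory.Balaban1983to89.B6Decomp247LatticeTwoSided
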